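import Mathlib

/-!
# T⁴ programme, spine node NE2 (U1a), lane P2 — LEAF L0-OP of the variational route: FORM SANDWICH ⟹ OPERATOR NORM
# (`t4/skeletons/NE2-t4-ne2-p2.md` §2; cell `pub-balaban`, row NE2 co-owner #2, lineage t4-ne2-p2 gen 9)

HONEST FRAMING: pure finite-dimensional linear algebra ([folklore]), no Bałaban object occurs.  It is the adapter that turns the
variational route's FORM-level conclusion `0 ≤ ⟨B,(Δ_{k+1} − Δ_k)B⟩ ≤ ε_k⟨B,Δ_kB⟩` into the OPERATOR-NORM currency of row NE2's
consumer (`CovariantAveragingTower.OneStepAveragedLaw`: `‖X_{k+1} − X_k‖ ≤ e_k`).  Rung (B)+1 bookkeeping; NOT summit progress.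

* `re_star_dotProduct_mulVec_eq` — `re ⟪Xv, v⟫ = re (v† X v)` for the Euclidean inner product;
* `opNorm_le_of_quadForm` — a Hermitian matrix whose quadratic form satisfies `|re (v†Xv)| ≤ M‖v‖²` has `ℓ²`-operator norm `≤ M`
  (Mathlib's `ContinuousLinearMap.norm_eq_iSup_rayleighQuotient` for symmetric operators);
* `opNorm_sub_le_of_form_sandwich` — Hermitian `X₀, X₁` with `0 ≤ re v†(X₁−X₀)v ≤ ε·re v†X₀v` and `re v†X₀v ≤ Λ‖v‖²` satisfy
  `‖X₁ − X₀‖ ≤ ε·Λ`.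
-/

open scoped Matrix ComplexConjugate Matrix.Norms.L2Operator InnerProductSpace

namespace Summit.QuantumFields.BalabanUV.T4Continuum.VariationalOpNorm

variable {ι : Type*} [Fintype ι] [DecidableEq ι]

/-- the Euclidean inner product of `Xv` with `v` has real part `re (v† X v)`. [folklore] -/
theorem re_inner_toEuclideanCLM (X : Matrix ι ι ℂ) (x : EuclideanSpace ℂ ι) :
    RCLike.re ⟪Matrix.toEuclideanCLM (n := ι) (𝕜 := ℂ) X x, x⟫_ℂ
      = (star (WithLp.ofLp x) ⬝ᵥ (X *ᵥ WithLp.ofLp x)).re := by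
  rw [EuclideanSpace.inner_eq_star_dotProduct, Matrix.ofLp_toEuclideanCLM]
  -- `ofLp x ⬝ᵥ star (X v) = conj (star v ⬝ᵥ X v)`
  have h : WithLp.ofLp x ⬝ᵥ star (X *ᵥ WithLp.ofLp x)
      = conj (star (WithLp.ofLp x) ⬝ᵥ (X *ᵥ WithLp.ofLp x)) := by
    simp only [dotProduct, Pi.star_apply, map_sum, map_mul, Complex.star_def, Complex.conj_conj, mul_comm]
  rw [h]
  exact Complex.conj_re _

omit [DecidableEq ι] in
/-- the squared Euclidean norm is `Σ_i |v_i|²`. [folklore] -/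
theorem norm_sq_eq_sum (x : EuclideanSpace ℂ ι) : ‖x‖ ^ 2 = ∑ i, ‖WithLp.ofLp x i‖ ^ 2 :=
  EuclideanSpace.norm_sq_eq x

/-- **FORM BOUND ⟹ OPERATOR NORM** for a Hermitian matrix: if `|re (v† X v)| ≤ M·Σ|v_i|²` for every `v`, then `‖X‖ ≤ M`
(the `ℓ² → ℓ²` operator norm of `Matrix.Norms.L2Operator`). [folklore] -/
theorem opNorm_le_of_quadForm {X : Matrix ι ι ℂ} (hX : X.IsHermitian) {M : ℝ} (hM : 0 ≤ M)
    (h : ∀ v : ι → ℂ, |(star v ⬝ᵥ (X *ᵥ v)).re| ≤ M * ∑ i, ‖v i‖ ^ 2) : ‖X‖ ≤ M := by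
  rw [Matrix.cstar_norm_def]
  set T := Matrix.toEuclideanCLM (n := ι) (𝕜 := ℂ) X with hT
  have hsym : (T : EuclideanSpace ℂ ι →ₗ[ℂ] EuclideanSpace ℂ ι).IsSymmetric := by
    rw [hT, Matrix.coe_toEuclideanCLM_eq_toEuclideanLin]
    exact Matrix.isSymmetric_toEuclideanLin_iff.mpr hX
  rw [ContinuousLinearMap.norm_eq_iSup_rayleighQuotient T hsym]
  refine ciSup_le fun x => ?_
  rw [ContinuousLinearMap.rayleighQuotient, ContinuousLinearMap.reApplyInnerSelf_apply, abs_div,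
    abs_of_nonneg (sq_nonneg ‖x‖)]
  by_cases hx : ‖x‖ = 0
  · rw [hx]; simp [hM]
  have hxpos : 0 < ‖x‖ ^ 2 := by positivity
  rw [div_le_iff₀ hxpos, hT, re_inner_toEuclideanCLM, norm_sq_eq_sum]
  exact h (WithLp.ofLp x)

/-- **FORM SANDWICH ⟹ OPERATOR-NORM RATE**: Hermitian `X₀, X₁` with `0 ≤ re v†(X₁ − X₀)v ≤ ε·re v†X₀v` for all `v` and the
a-priori bound `re v†X₀v ≤ Λ·Σ|v_i|²` satisfy `‖X₁ − X₀‖ ≤ ε·Λ`.  (For the variational route: `X₀ = Δ_k`, `X₁ = Δ_{k+1}`,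
`ε = C₁L^{−2k}`, `Λ` from (1.67).) [folklore] -/
theorem opNorm_sub_le_of_form_sandwich {X₀ X₁ : Matrix ι ι ℂ} (h₀ : X₀.IsHermitian) (h₁ : X₁.IsHermitian) {ε Λ : ℝ}
    (hε : 0 ≤ ε) (hΛ : 0 ≤ Λ)
    (hlow : ∀ v : ι → ℂ, 0 ≤ (star v ⬝ᵥ ((X₁ - X₀) *ᵥ v)).re)
    (hup : ∀ v : ι → ℂ, (star v ⬝ᵥ ((X₁ - X₀) *ᵥ v)).re ≤ ε * (star v ⬝ᵥ (X₀ *ᵥ v)).re)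
    (hbd : ∀ v : ι → ℂ, (star v ⬝ᵥ (X₀ *ᵥ v)).re ≤ Λ * ∑ i, ‖v i‖ ^ 2) :
    ‖X₁ - X₀‖ ≤ ε * Λ := by
  refine opNorm_le_of_quadForm (h₁.sub h₀) (mul_nonneg hε hΛ) fun v => ?_
  rw [abs_of_nonneg (hlow v)]
  calc (star v ⬝ᵥ ((X₁ - X₀) *ᵥ v)).re ≤ ε * (star v ⬝ᵥ (X₀ *ᵥ v)).re := hup v
    _ ≤ ε * (Λ * ∑ i, ‖v i‖ ^ 2) := mul_le_mul_of_nonneg_left (hbd v) hε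
    _ = ε * Λ * ∑ i, ‖v i‖ ^ 2 := by ring

end Summit.QuantumFields.BalabanUV.T4Continuum.VariationalOpNorm
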